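import Literature.NumberTheory.Automorphic.NewformAdelisationArchCovariance
import Literature.NumberTheory.Automorphic.GL2ZFiniteOfEigenfunction
import Literature.NumberTheory.Automorphic.NewformAdelisationCuspidal
import Literature.NumberTheory.Automorphic.AutomorphicRepsGLCuspBridgeProofs
import Literature.NumberTheory.Automorphic.GLnCuspidalSpectrumSiegel
import Literature.NumberTheory.Automorphic.GL2RealRotationExp
import HarnessLib

/-! # Stub stub_adelicLiftIsCuspForm of line adelic-newform-datum-double-twist (crux stmt-Langlands-12944 `PhantomRMYoshida.SerreKWAutomorphicGL2`)

Route `PhantomRMYoshida`, crux `SerreKWAutomorphicGL2` (stmt-Langlands-12944), line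
`adelic-newform-datum-double-twist`, Stub 5 `stub_adelicLiftIsCuspForm` (registered signature,
verbatim): **the adelic lift of a holomorphic cusp form is a cusp form on `GL₂(𝔸_ℚ)` in the sense
of Borel–Jacquet.**  For `f ∈ S_w(Γ₁(N))` and its adelic lift `φ_f = adelicLiftFunA N w f` on
`GL₂(𝔸_ℚ)`, IF `φ_f` is smooth in the archimedean variable of the `GL₂/ℚ` automorphy datum (`hsm`)
and killed by the lowering operator `X` along `ι_𝔸 : GL₂(ℝ) → GL₂(𝔸_ℚ)` (`hlow`; both are the
conclusions of the sibling stub `stub_loweringKillsLift`), THEN `IsCuspFormGL 2 ℚ hcpt φ_f`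
(Gelbart 1975, Prop. 3.1 (i)–(vii); Bump 1997, §3.6, Thm. 3.6.1; Borel–Jacquet 1979, 4.2 and 4.4).

Proof, clause by clause of `IsAutomorphicForm` (Borel–Jacquet 4.2) plus the cusp condition (4.4),
every input being PROVED in the tree:

* (a) left `GL₂(ℚ)`-invariance: `adelicLiftFun_ofGlobal_mul`;
* (a') level `K(N)`: `principalCongruenceLevel_mem_finiteLevelsGL_holds` and
  `adelicLiftFun_mul_of_mem_principalCongruenceLevel`;
* (b) smoothness: the hypothesis `hsm`;
* (b') `K_∞`-finiteness: `K_∞ = O(2) = SO(2) ⊔ ε SO(2)` (`mem_Kinf_iff`, `ℝ ≅ mixedSpace ℚ`,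
  `GL2Real.exists_kappa_of_orthogonal`) and `φ_f(a ι_𝔸(r(θ))) = e^{-iwθ} φ_f(a)`
  (`adelicLiftFun_mul_ofRealGLA_rotGL`), so every right `K_∞`-translate of `φ_f` lies in the plane
  spanned by `φ_f` and `r(ε) φ_f`;
* (c) `Z(𝔤)`-finiteness: `Rat.isZFinite_of_casimir_of_zed` with `s₁ = (w-1)/2`, `s₂ = (1-w)/2`; the
  Casimir eigen-equation `∑ E_{ab} E_{ba} φ_f = ((w-1)²/2 - ½) φ_f` is FIRST ORDER given `hlow`:
  `X̄ X φ = 2Ω φ + W(Wφ) - 2i Wφ` (`GL2Real.raiseFun_lowerFun`), `W φ_f = iw φ_f`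
  (`lieDeriv_rotGen_adelicLiftFunA`), `Z φ_f = 0` (`lieDeriv_one_adelicLiftFunA`),
  `C = Ω + ½ Z²` (`GL2Real.casimirFun_add_half_zz`);
* (d) moderate growth with exponent `0`: `exists_bound_adelicLiftFun`;
* cusp condition along the Borel: `constantTermVanishes_adelicLift` transported through the
  inversion dictionary `invQuot (adelicLift N w f) = φ_f`
  (`AutomorphicRepsGL.cuspConditionGL_invQuot_iff_holds`).

## References

* S. Gelbart, *Automorphic forms on adele groups*, Ann. of Math. Stud. 83 (1975), §3, Prop. 3.1.
* D. Bump, *Automorphic Forms and Representations* (1997), §2.2, §3.6, Thm. 3.6.1.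
* A. Borel, H. Jacquet, *Automorphic forms and automorphic representations*, Corvallis 1979, 4.2, 4.4.
-/

noncomputable section

-- (H5) the place subtypes indexing the factors of `mixedSpace ℚ` use classical `Fintype` instances, as in `AdelicGLnGlue`.
open scoped MatrixGroups Matrix Classical
open NumberField NumberField.mixedEmbedding CongruenceSubgroup Literature.NumberTheory.Automorphic

namespace Summit.Langlands.Langlands.Cruxes.SerreKWAutomorphicGL2.AdelicNewformDatumDoubleTwist

-- `Summit.Langlands.Langlands.…` (summit = sub-problem name, D-0017 layout) trips `dupNamespace` on every decl.
set_option linter.dupNamespace false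

open GL2Real

/-! ## `K_∞ = O(2)`: elements of `K_∞ ≤ GL₂(mixedSpace ℚ)` are real rotations or reflected rotations -/

section Kinf

/-- `ℝ ≅ mixedSpace ℚ`: the structure map is a left inverse of the evaluation at the (unique, real)
infinite place of `ℚ`. [folklore] -/
theorem algebraMap_mixedSpaceEvalReal (w : {w : InfinitePlace ℚ // w.IsReal}) (x : mixedSpace ℚ) :
    algebraMap ℝ (mixedSpace ℚ) (mixedSpaceEvalReal ℚ w x) = x := by
  obtain ⟨t, rfl⟩ := Rat.bijective_algebraMap_mixedSpace.2 x
  congr 1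

/-- **`K_∞ = O(2) ⊗ 1`**: every element of `K_∞ ≤ GL₂(mixedSpace ℚ)` is `g ⊗ 1` for a real
orthogonal `g ∈ GL₂(ℝ)`, `gᵀ g = 1` (`mem_Kinf_iff` at the real place and `ℝ ≅ mixedSpace ℚ`).
Borel–Jacquet 1979, §1.1 and §4.1 (`K_∞ = ∏_{w real} O(n) × ∏_{w complex} U(n)`).
[cite: BorelJacquet1979, §1.1 and §4.1] -/
theorem exists_realToMixedGL_eq_of_mem_Kinf {κ : GL (Fin 2) (mixedSpace ℚ)} (hκ : κ ∈ Kinf 2 ℚ) :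
    ∃ g : GL (Fin 2) ℝ, (g : Matrix (Fin 2) (Fin 2) ℝ)ᵀ * g = 1 ∧ Rat.realToMixedGL 2 g = κ := by
  let w₀ : {w : InfinitePlace ℚ // w.IsReal} := ⟨Rat.infinitePlace, Rat.isReal_infinitePlace⟩
  refine ⟨Matrix.GeneralLinearGroup.map (mixedSpaceEvalReal ℚ w₀) κ, ?_, ?_⟩
  · have h := ((mem_Kinf_iff 2 ℚ κ).1 hκ).1 w₀
    rw [mem_unitarySubgroupGL_iff, Matrix.star_eq_conjTranspose,
      Matrix.conjTranspose_eq_transpose_of_trivial] at h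
    exact h
  · refine Matrix.GeneralLinearGroup.ext fun i j => ?_
    exact algebraMap_mixedSpaceEvalReal w₀ _

/-- **`O(2) = SO(2) ⊔ ε SO(2)`** in terms of the tree's `rotGL`, `epsGL`: a real `2 × 2` matrix with
`gᵀ g = 1` is a rotation `r(θ)` or `ε r(θ)`, `ε = diag(1, -1)` (`GL2Real.exists_kappa_of_orthogonal`,
`κ_θ = r(-θ)`, `κ_θ X₁ = r(-θ) ε = ε r(θ)`). [folklore] -/
theorem exists_eq_rotGL_or_eq_epsGL_mul_rotGL {g : GL (Fin 2) ℝ}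
    (hg : (g : Matrix (Fin 2) (Fin 2) ℝ)ᵀ * g = 1) :
    ∃ θ : ℝ, g = rotGL θ ∨ g = epsGL * rotGL θ := by
  obtain ⟨θ, h | h⟩ := exists_kappa_of_orthogonal hg
  · refine ⟨-θ, Or.inl (Units.ext ?_)⟩
    rw [h, kappa_eq, coe_rotGL, Real.cos_neg, Real.sin_neg, neg_neg]
  · refine ⟨θ, Or.inr ?_⟩
    have h1 : g = rotGL (-θ) * epsGL := by
      refine Units.ext ?_
      rw [h, Units.val_mul, kappa_eq, coe_rotGL, coe_epsGL, Real.cos_neg, Real.sin_neg, neg_neg]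
      rfl
    rw [h1, ← epsGL_mul_rotGL_mul_epsGL θ, mul_assoc, epsGL_mul_epsGL, mul_one]

end Kinf

/-! ## The clauses of `IsAutomorphicForm` and the cusp condition for `φ_f` -/

section Lift

variable {N : ℕ} [NeZero N] {k : ℤ} (f : CuspForm (Gamma1 N) k)
  {hcpt : isCompact_glFiniteIntegralLevel 2 ℚ}

/-- (a) **Left `GL₂(ℚ)`-invariance** of `φ_f` (`adelicLiftFun_ofGlobal_mul`; the arithmetic subgroup
of the `GL₂` datum is the range of the diagonal embedding). Gelbart 1975, Prop. 3.1 (i).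
[cite: Gelbart1975, Prop. 3.1] -/
theorem isLeftInvariant_adelicLiftFunA :
    IsLeftInvariant (AdelicGroupData.gl 2 ℚ) (adelicLiftFunA N k f) := by
  rintro _ ⟨γ, rfl⟩ g
  exact adelicLiftFun_ofGlobal_mul f γ g

/-- (a') **Level**: `φ_f` is right invariant under the admissible level `K(N)`
(`principalCongruenceLevel_mem_finiteLevelsGL_holds`,
`adelicLiftFun_mul_of_mem_principalCongruenceLevel`). Gelbart 1975, Prop. 3.1 (ii).
[cite: Gelbart1975, Prop. 3.1] -/
theorem exists_level_adelicLiftFunA :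
    ∃ U ∈ (AutomorphyDatum.gl 2 ℚ hcpt).finiteLevels, IsRightInvariantUnder U (adelicLiftFunA N k f) :=
  ⟨(show Subgroup (AdelicGroupData.gl 2 ℚ).Adelic from principalCongruenceLevel 2 ℚ (Ideal.span {(N : 𝓞 ℚ)})),
    principalCongruenceLevel_mem_finiteLevelsGL_holds 2 ℚ (span_natCast_level_ne_zero (N := N)),
    fun _ hu g => adelicLiftFun_mul_of_mem_principalCongruenceLevel f hu g⟩

/-- (b') **The `K_∞`-translates of `φ_f` span at most a plane**: every right `K_∞`-translate of
`φ_f` lies in the span of `φ_f` and `a ↦ φ_f(a ι_𝔸(ε))`, because `K_∞ = SO(2) ⊔ ε SO(2)`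
(`exists_realToMixedGL_eq_of_mem_Kinf`, `exists_eq_rotGL_or_eq_epsGL_mul_rotGL`) and
`φ_f(a ι_𝔸(r(θ))) = e^{-ikθ} φ_f(a)` at every adelic point (`adelicLiftFun_mul_ofRealGLA_rotGL`).
This is the `K_∞`-finiteness of `φ_f` (Gelbart 1975, Prop. 3.1 (iii); Borel–Jacquet 1979, 4.2 (b)).
[cite: Gelbart1975, Prop. 3.1] [cite: BorelJacquet1979, 4.2] -/
theorem kTranslateSpan_adelicLiftFunA_le_pair :
    kTranslateSpan (AutomorphyDatum.gl 2 ℚ hcpt).ofArch (adelicLiftFunA N k f) ≤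
      Submodule.span ℂ {adelicLiftFunA N k f,
        fun a : (AdelicGroupData.gl 2 ℚ).Adelic => adelicLiftFunA N k f (a * Rat.ofRealGLA epsGL)} := by
  set φ : (AdelicGroupData.gl 2 ℚ).Adelic → ℂ := adelicLiftFunA N k f with hφ
  set φε : (AdelicGroupData.gl 2 ℚ).Adelic → ℂ := fun a => φ (a * Rat.ofRealGLA epsGL) with hφε
  set V : Submodule ℂ ((AdelicGroupData.gl 2 ℚ).Adelic → ℂ) := Submodule.span ℂ {φ, φε} with hV
  refine Submodule.span_le.2 ?_
  rintro _ ⟨κ, rfl⟩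
  dsimp only
  rw [SetLike.mem_coe]
  obtain ⟨g, hg, hgκ⟩ := exists_realToMixedGL_eq_of_mem_Kinf κ.2
  -- the translate by `κ = g ⊗ 1` is `a ↦ φ (a (g, 1))`
  have htr : archTranslate (AutomorphyDatum.gl 2 ℚ hcpt).ofArch
      (Subgroup.inclusion (AutomorphyDatum.gl 2 ℚ hcpt).arch.maximalCompact_le_carrier κ) φ =
      fun a => φ (a * Rat.ofRealGLA g) := by
    funext a
    rw [archTranslate_apply]
    congr 2
    change (AutomorphyDatum.gl 2 ℚ hcpt).ofArch _ = (Rat.ofRealGL 2 g : GL (Fin 2) (AdeleRing (𝓞 ℚ) ℚ))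
    rw [Rat.ofRealGL_eq_ofInfinite, hgκ]
    rfl
  rw [htr]
  obtain ⟨θ, rfl | rfl⟩ := exists_eq_rotGL_or_eq_epsGL_mul_rotGL hg
  · have h : (fun a : (AdelicGroupData.gl 2 ℚ).Adelic => φ (a * Rat.ofRealGLA (rotGL θ))) =
        (Complex.exp (θ * Complex.I) ^ (-k)) • φ := by
      funext a
      change adelicLiftFun N k f ((show GL (Fin 2) (AdeleRing (𝓞 ℚ) ℚ) from a) * Rat.ofRealGL 2 (rotGL θ)) =
        Complex.exp (θ * Complex.I) ^ (-k) * adelicLiftFun N k f (show GL (Fin 2) (AdeleRing (𝓞 ℚ) ℚ) from a)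
      rw [adelicLiftFun_mul_ofRealGLA_rotGL f _ θ, mul_comm]
    rw [h]
    exact V.smul_mem _ (Submodule.subset_span (Set.mem_insert _ _))
  · have h : (fun a : (AdelicGroupData.gl 2 ℚ).Adelic => φ (a * Rat.ofRealGLA (epsGL * rotGL θ))) =
        (Complex.exp (θ * Complex.I) ^ (-k)) • φε := by
      funext a
      change adelicLiftFun N k f ((show GL (Fin 2) (AdeleRing (𝓞 ℚ) ℚ) from a) * Rat.ofRealGL 2 (epsGL * rotGL θ)) =
        Complex.exp (θ * Complex.I) ^ (-k) *
          adelicLiftFun N k f ((show GL (Fin 2) (AdeleRing (𝓞 ℚ) ℚ) from a) * Rat.ofRealGL 2 epsGL)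
      rw [map_mul, ← mul_assoc, adelicLiftFun_mul_ofRealGLA_rotGL f _ θ, mul_comm]
    rw [h]
    exact V.smul_mem _ (Submodule.subset_span (Set.mem_insert_of_mem _ (Set.mem_singleton _)))

/-- **`Ω φ_f = ((k² - 2k)/2) φ_f` along `ι_𝔸` from `X φ_f = 0`** (`Ω = ½h² + ef + fe`,
`GL2Real.casimirFun`): `X̄(X φ) = 2Ω φ + W(W φ) - 2i W φ` (`GL2Real.raiseFun_lowerFun`) with
`X φ_f = 0` (hypothesis) and `W φ_f = ik φ_f` (`lieDeriv_rotGen_adelicLiftFunA`). Bump 1997, §2.1,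
Exercise 2.1.7 (b), Prop. 2.2.5; Gelbart 1997, Remark 2.5.5.
[cite: Bump1997, Prop. 2.2.5 and Exercise 2.1.7] -/
theorem casimirFun_adelicLiftFunA_of_lowerFun_eq_zero
    (hsm : IsArchSmooth (AutomorphyDatum.gl 2 ℚ hcpt).ofArch (adelicLiftFunA N k f))
    (hlow : lowerFun Rat.iotaA (adelicLiftFunA N k f) = 0) :
    casimirFun Rat.iotaA (adelicLiftFunA N k f) = (((k : ℂ) ^ 2 - 2 * k) / 2) • adelicLiftFunA N k f := by
  have hA : IsArchSmooth Rat.iotaA (adelicLiftFunA N k f) := IsArchSmooth.iotaA hsm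
  have h := raiseFun_lowerFun hA
  have hW := lieDeriv_rotGen_adelicLiftFunA (N := N) (k := k) f
  have h0 : raiseFun Rat.iotaA (0 : (AdelicGroupData.gl 2 ℚ).Adelic → ℂ) = 0 := by
    unfold raiseFun
    simp only [lieDeriv_zero_right, add_zero, smul_zero]
  rw [hlow, h0, hW, lieDeriv_smul, hW, smul_smul] at h
  funext x
  have hx := congrFun h x
  simp only [Pi.add_apply, Pi.sub_apply, Pi.smul_apply, Pi.zero_apply, smul_eq_mul] at hx
  simp only [Pi.smul_apply, smul_eq_mul]
  linear_combination (-(1 / 2 : ℂ)) * hx +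
    ((k : ℂ) * adelicLiftFunA N k f x - (k : ℂ) ^ 2 * adelicLiftFunA N k f x / 2) * Complex.I_sq

/-- **The Casimir eigen-equation `C φ_f = ∑_{a,b} E_{ab}(E_{ba} φ_f) = ((k-1)²/4 + (1-k)²/4 - ½) φ_f`
along `ι_𝔸` from `X φ_f = 0`** (`C = Ω + ½Z²`, `GL2Real.casimirFun_add_half_zz`; `Z φ_f = 0`,
`lieDeriv_one_adelicLiftFunA`): the Casimir scalar `s₁² + s₂² - ½` of the Harish-Chandra parameter
`{s₁, s₂} = {(k-1)/2, (1-k)/2}` of the discrete series `D_k` (Knapp 2002, Thm. 5.44), in the shape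
consumed by `Rat.isZFinite_of_casimir_of_zed`. [cite: Knapp2002, Thm. 5.44] [cite: Bump1997, §2.2] -/
theorem sum_lieDeriv_single_adelicLiftFunA_of_lowerFun_eq_zero
    (hsm : IsArchSmooth (AutomorphyDatum.gl 2 ℚ hcpt).ofArch (adelicLiftFunA N k f))
    (hlow : lowerFun Rat.iotaA (adelicLiftFunA N k f) = 0) :
    (∑ a : Fin 2, ∑ b : Fin 2, lieDeriv Rat.iotaA (toLie (Matrix.single a b (1 : ℝ)))
        (lieDeriv Rat.iotaA (toLie (Matrix.single b a (1 : ℝ))) (adelicLiftFunA N k f))) =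
      ((((k : ℂ) - 1) / 2) ^ 2 + ((1 - (k : ℂ)) / 2) ^ 2 - 1 / 2) • adelicLiftFunA N k f := by
  have hA : IsArchSmooth Rat.iotaA (adelicLiftFunA N k f) := IsArchSmooth.iotaA hsm
  have h := casimirFun_add_half_zz hA
  rw [lieDeriv_one_adelicLiftFunA, lieDeriv_zero_right, smul_zero, add_zero,
    casimirFun_adelicLiftFunA_of_lowerFun_eq_zero f hsm hlow] at h
  rw [← h]
  congr 1
  ring

/-- (c) **`Z(𝔤)`-finiteness of `φ_f`** (`Rat.isZFinite_of_casimir_of_zed` with `s₁ = (k-1)/2`,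
`s₂ = (1-k)/2`: Casimir eigenvalue `s₁² + s₂² - ½` from `X φ_f = 0`, central eigenvalue
`s₁ + s₂ = 0 = Z φ_f`). Gelbart 1975, Prop. 3.1 (vi); Borel–Jacquet 1979, 4.2 (c).
[cite: Gelbart1975, Prop. 3.1] [cite: BorelJacquet1979, 4.2] -/
theorem isZFinite_adelicLiftFunA
    (hsm : IsArchSmooth (AutomorphyDatum.gl 2 ℚ hcpt).ofArch (adelicLiftFunA N k f))
    (hlow : lowerFun Rat.iotaA (adelicLiftFunA N k f) = 0) :
    IsZFinite (AutomorphyDatum.gl 2 ℚ hcpt).ofArch (adelicLiftFunA N k f) :=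
  Rat.isZFinite_of_casimir_of_zed (s₁ := ((k : ℂ) - 1) / 2) (s₂ := (1 - (k : ℂ)) / 2) hsm
    (sum_lieDeriv_single_adelicLiftFunA_of_lowerFun_eq_zero f hsm hlow)
    (by rw [lieDeriv_one_adelicLiftFunA, show ((k : ℂ) - 1) / 2 + (1 - (k : ℂ)) / 2 = 0 by ring, zero_smul])

/-- (d) **Moderate growth** of `φ_f`, with exponent `0`: `φ_f` is bounded (`exists_bound_adelicLiftFun`).
Gelbart 1975, Prop. 3.1 (iv) and §3.A, p. 28; Borel–Jacquet 1979, 4.2 (d).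
[cite: Gelbart1975, §3.A, p. 28] -/
theorem hasModerateGrowth_adelicLiftFunA :
    HasModerateGrowth (AutomorphyDatum.gl 2 ℚ hcpt) (adelicLiftFunA N k f) := by
  obtain ⟨C, hC⟩ := exists_bound_adelicLiftFun (N := N) (k := k) f
  exact ⟨C, 0, fun g => by rw [pow_zero, mul_one]; exact hC g⟩

/-- The inversion dictionary returns `φ_f`: `invQuot (adelicLift N k f) = φ_f`
(`adelicLift [x] = φ_f(x⁻¹)`). [folklore] -/
theorem invQuot_adelicLift :
    invQuot (AdelicGroupData.gl 2 ℚ) (adelicLift N k f) = adelicLiftFunA N k f := by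
  funext g
  rw [invQuot_apply, adelicLift_toAutomorphicQuotient]
  exact congrArg (adelicLiftFun N k f) (inv_inv g)

/-- **The cusp condition along the Borel** for `φ_f` (`CuspConditionGL 2 ℚ φ_f 1`): the proved
cuspidality `constantTermVanishes_adelicLift` of the lift on the automorphic quotient, transported
through the inversion bridge `AutomorphicRepsGL.cuspConditionGL_invQuot_iff_holds`. Gelbart 1975,
Prop. 3.1 (vii); Borel–Jacquet 1979, 4.4. [cite: Gelbart1975, Prop. 3.1] [cite: BorelJacquet1979, 4.4] -/
theorem cuspConditionGL_adelicLiftFunA : CuspConditionGL 2 ℚ (adelicLiftFunA N k f) 1 := by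
  rw [← invQuot_adelicLift f]
  exact (AutomorphicRepsGL.cuspConditionGL_invQuot_iff_holds 2 ℚ (adelicLift N k f) 1).2
    (constantTermVanishes_adelicLift f)

/-- **`φ_f` is an automorphic form on `GL₂(𝔸_ℚ)`** (Borel–Jacquet 1979, 4.2), given archimedean
smoothness and `X φ_f = 0`: clauses (a), (a'), (c), (d) above, (b) = `hsm`, and (b') `K_∞`-finiteness
from `kTranslateSpan_adelicLiftFunA_le_pair` (the translates span a space of dimension `≤ 2`).
Gelbart 1975, Prop. 3.1; Bump 1997, Thm. 3.6.1. [cite: Gelbart1975, Prop. 3.1] [cite: BorelJacquet1979, 4.2] -/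
theorem isAutomorphicForm_adelicLiftFunA
    (hsm : IsArchSmooth (AutomorphyDatum.gl 2 ℚ hcpt).ofArch (adelicLiftFunA N k f))
    (hlow : lowerFun Rat.iotaA (adelicLiftFunA N k f) = 0) :
    IsAutomorphicForm (AutomorphyDatum.gl 2 ℚ hcpt) (adelicLiftFunA N k f) where
  leftInvariant := isLeftInvariant_adelicLiftFunA f
  exists_level := exists_level_adelicLiftFunA f
  archSmooth := hsm
  kFinite :=
    haveI : FiniteDimensional ℂ (Submodule.span ℂ ({adelicLiftFunA N k f,
        fun a : (AdelicGroupData.gl 2 ℚ).Adelic => adelicLiftFunA N k f (a * Rat.ofRealGLA epsGL)} :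
          Set ((AdelicGroupData.gl 2 ℚ).Adelic → ℂ))) :=
      FiniteDimensional.span_of_finite ℂ (Set.toFinite _)
    Submodule.finiteDimensional_of_le (kTranslateSpan_adelicLiftFunA_le_pair f)
  zFinite := isZFinite_adelicLiftFunA f hsm hlow
  moderateGrowth := hasModerateGrowth_adelicLiftFunA f

/-- **`φ_f` is a cusp form on `GL₂(𝔸_ℚ)`** (`IsCuspFormGL 2 ℚ hcpt φ_f`), given archimedean smoothness
and `X φ_f = 0`: an automorphic form (`isAutomorphicForm_adelicLiftFunA`) whose only constant term,
along the Borel (`0 < j < 2` forces `j = 1`), vanishes (`cuspConditionGL_adelicLiftFunA`).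
Gelbart 1975, Prop. 3.1; Bump 1997, Thm. 3.6.1; Borel–Jacquet 1979, 4.4.
[cite: Gelbart1975, Prop. 3.1] [cite: Bump1997, §3.6, Thm. 3.6.1] [cite: BorelJacquet1979, 4.4] -/
theorem isCuspFormGL_adelicLiftFunA
    (hsm : IsArchSmooth (AutomorphyDatum.gl 2 ℚ hcpt).ofArch (adelicLiftFunA N k f))
    (hlow : lowerFun Rat.iotaA (adelicLiftFunA N k f) = 0) :
    IsCuspFormGL 2 ℚ hcpt (adelicLiftFunA N k f) := by
  refine ⟨isAutomorphicForm_adelicLiftFunA f hsm hlow, fun j hj hj2 => ?_⟩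
  obtain rfl : j = 1 := by omega
  exact cuspConditionGL_adelicLiftFunA f

end Lift

/-! ## The registered stub -/

/-- **Stub 5 (`φ_f ∈ 𝒜₀(GL₂)` from Stub 4; classical analysis).**  For every cusp form
`f ∈ S_w(Γ₁(N))`, `w ≥ 2`, and every compactness witness `hcpt`: IF the adelic lift
`φ_f = adelicLiftFunA N w f : GL₂(𝔸_ℚ) → ℂ` is smooth in the archimedean variable and killed by the
lowering operator along `ι_𝔸`, THEN `φ_f` is a CUSP FORM in the Borel–Jacquet sense,
`IsCuspFormGL 2 ℚ hcpt` (`isCuspFormGL_adelicLiftFunA`; the weight bound `2 ≤ w` is not used).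
Gelbart 1975, Prop. 3.1 (i)–(vii); Bump 1997, §3.6, Thm. 3.6.1; Borel–Jacquet 1979, 4.2 and 4.4.
[cite: Gelbart1975, Prop. 3.1, p. 28] [cite: Bump1997, §3.6, Thm. 3.6.1] [cite: BorelJacquet1979, 4.2 and 4.4] -/
theorem stub_adelicLiftIsCuspForm :
    ∀ (N : ℕ) [NeZero N] (w : ℤ), 2 ≤ w → ∀ (f : CuspForm (Gamma1 N) w)
      (hcpt : isCompact_glFiniteIntegralLevel 2 ℚ),
      IsArchSmooth (AutomorphyDatum.gl 2 ℚ hcpt).ofArch (adelicLiftFunA N w ⇑f) →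
      GL2Real.lowerFun Rat.iotaA (adelicLiftFunA N w ⇑f) = 0 →
      IsCuspFormGL 2 ℚ hcpt (adelicLiftFunA N w ⇑f) := by
  intro N _ w _ f hcpt hsm hlow
  exact isCuspFormGL_adelicLiftFunA f hsm hlow

end Summit.Langlands.Langlands.Cruxes.SerreKWAutomorphicGL2.AdelicNewformDatumDoubleTwist

end
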